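import Summits.QuantumFields.YangMills.Theorems.BalabanLadderIRGaugeImageBlind
import HarnessLib

/-!
# Gauge-image blindness of Wilson DLR kernels, II — one-sided blindness, the sandwich channel, the observable side

Count-neutral helper lemmas for crux `stmt-QuantumFields-19354` (`BalabanLadder.IR`), typed by the crux-ideate seat
ym-cruxidea-19354-2 (gen 3, card `orbit-blind-collars-locate-the-row`, `Sketch-g3.lean` sha16 47d20d20eb75f8bf §3,
evidence #46 on the item; (C2)–(C3) of owner READING R44) and landed verbatim up to the import swap.  ROUTE-INDEPENDENT
(no `Theses` import).

## What is proved here (exact identities; `g_h = twistFn t₀ h` is the LAYER gauge transformation)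

* ONE-SIDED BLINDNESS `integral_layerTwist_eq_of_upper_resampled` ∕ `_of_lower_resampled`: the layer transformation
  `g_h = h·𝟙_{x₀ > t₀}` (`t₀` inside the centre cell's height range) is EXACTLY invisible at the centre cell as soon as
  the row-`0` neighbours and the UPPER `3³`-block of cells (`c 0 = 1, |c_j| ≤ 1`) are resampled (any `h`), resp. the
  LOWER block (`c 0 = -1`) for CENTRAL `h` (a global central constant acts trivially, `gaugeTransformZd_mul_central`).
* THE LOCATED CHANNEL (C2) `layerTwist_visible_imp_sandwiched`: a visible centre twist needs FROZEN cells in BOTH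
  normal `3³`-blocks — a two-sided one-cell sandwich.
* OBSERVABLE SIDE (C3) `integral_layerTwist_eq_of_not_topReaching` ∕ `_of_not_bottomTouching`: with only the row-`0`
  block resampled (frozen faces allowed on both sides), a cylinder of centre-cell edges NOT reaching the top face, or
  NOT touching the bottom face, is exactly twist-blind: visibility needs a FACE-TO-FACE charged observable.

Nothing here refutes or proves `IR`; HONEST FRAMING: kernel bookkeeping for an OPEN crux of a conditional chain.
-/

noncomputable section

open MeasureTheory
open Literature.MathematicalPhysics.QuantumFieldTheory Literature.MathematicalPhysics.QuantumLattice
open Literature.Probability.LatticeModels (Site)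
open Summit.QuantumFields.YangMills.Cruxes.IR.Tempered (cellEdges regionEdges)
open Summit.QuantumFields.YangMills.Cruxes.IR.CellTempered.Engine (frameCell mem_cellEdges_frameCell)

namespace Summit.QuantumFields.YangMills.Cruxes.IR.CruxIdea2g3

section Geometry

/-! ## Endpoints of the top-avoiding and bottom-avoiding centre-cell edges -/

/-- An endpoint of a centre-cell edge not reaching the top face lies strictly below the top face. -/
theorem endpt_lt_top_of_notTopReaching {w : Fin 4 → ℤ → ℤ} {e₀ : Edge} (he₀ : e₀ ∈ notTopReaching w)
    {x : Site 4} (hx : IsEndpt e₀ x) : x 0 < w 0 1 := by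
  rw [notTopReaching, Finset.mem_filter] at he₀
  obtain ⟨he₀, hnt⟩ := he₀
  simp only [Summit.QuantumFields.YangMills.Cruxes.IR.Tempered.cellEdges, Finset.mem_product,
    Fintype.mem_piFinset, Finset.mem_Ico, Finset.mem_univ, and_true, Pi.zero_apply, zero_add] at he₀
  have h0 := he₀ 0
  rcases hx with rfl | rfl
  · exact h0.2
  · simp only [Pi.add_apply, Pi.single_apply]
    by_cases hi : (0 : Fin 4) = e₀.2
    · rw [if_pos hi]
      have : ¬ (e₀.2 = 0 ∧ e₀.1 0 + 1 = w 0 1) := hnt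
      have hne : e₀.1 0 + 1 ≠ w 0 1 := fun h => this ⟨hi.symm, h⟩
      omega
    · rw [if_neg hi]
      omega

/-- An endpoint of a centre-cell edge based strictly above the bottom face lies strictly above the bottom face. -/
theorem bottom_lt_endpt_of_notBottomTouching {w : Fin 4 → ℤ → ℤ} {e₀ : Edge} (he₀ : e₀ ∈ notBottomTouching w)
    {x : Site 4} (hx : IsEndpt e₀ x) : w 0 0 < x 0 := by
  rw [notBottomTouching, Finset.mem_filter] at he₀
  obtain ⟨-, hnb⟩ := he₀
  rcases hx with rfl | rfl
  · exact hnb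
  · simp only [Pi.add_apply, Pi.single_apply]
    split_ifs <;> omega

end Geometry

section Kernel

variable {G : Type} [Group G] [TopologicalSpace G] [IsTopologicalGroup G] [CompactSpace G]
  [MeasurableSpace G] [BorelSpace G]

/-! ## One-sided blindness -/

/-- **ONE-SIDED BLINDNESS, upper block resampled (exact, PROVED; any `h`).**  If `Y` contains every cell `c` with
`c 0 ∈ {0, 1}` and `|c j| ≤ 1 (j ≠ 0)` (the centre row's neighbours and the UPPER `3³`-block), then for a layer `t₀`
in the centre cell's height range `[w 0 0, w 0 1)` the layer transformation `g_h` is invisible at the centre cell,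
WHATEVER is frozen below or beyond. -/
theorem integral_layerTwist_eq_of_upper_resampled [SecondCountableTopology G] {N : ℕ}
    (ρ : G →* Matrix (Fin N) (Fin N) ℂ) (hρ : Continuous ρ) (β : ℝ) {w : Fin 4 → ℤ → ℤ}
    (hw1 : ∀ i j, w i j + 1 ≤ w i (j + 1)) (Y : Finset (Fin 4 → ℤ))
    (hY : ∀ c : Fin 4 → ℤ, (c 0 = 0 ∨ c 0 = 1) → (∀ k, k ≠ 0 → |c k| ≤ 1) → c ∈ Y)
    {t₀ : ℤ} (ht₀ : w 0 0 ≤ t₀) (h : G) (η : LGConfig 4 G)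
    (f : LGConfig 4 G → ℝ) (hf : IsCylinder f (cellEdges w 0)) (hfm : Measurable f) :
    ∫ U, f U ∂(ymSpecification ρ β (regionEdges w Y) (gaugeTransformZd (twistFn t₀ h) η)) =
      ∫ U, f U ∂(ymSpecification ρ β (regionEdges w Y) η) := by
  refine integral_gaugeImage_eq ρ hρ β _ _ _ η (fun e he x hx hx₀ => ?_) f hf hfm
  obtain ⟨e₀, he₀, hx₀⟩ := hx₀
  have hc : frameCell w e ∉ Y := frameCell_not_mem hw1 he
  by_cases hfar : ∃ k, 2 ≤ |frameCell w e k|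
  · obtain ⟨k, hk⟩ := hfar
    exact (not_touch_of_far hw1 hk (mem_cellEdges_frameCell hw1 e) he₀ hx hx₀).elim
  · push Not at hfar
    have hnear : ∀ k, |frameCell w e k| ≤ 1 := fun k => by have := hfar k; omega
    have hc0 : frameCell w e 0 = -1 := by
      have h01 : ¬ (frameCell w e 0 = 0 ∨ frameCell w e 0 = 1) := fun h01 =>
        hc (hY _ h01 fun k _ => hnear k)
      have := hnear 0
      rw [abs_le] at this
      omega
    have hx0 := (endpt_coord (mem_cellEdges_frameCell hw1 e) hx 0).2
    rw [hc0] at hx0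
    norm_num at hx0
    have : ¬ t₀ < x 0 := by omega
    simp [twistFn, this]

/-- **ONE-SIDED BLINDNESS, lower block resampled (exact, PROVED; central `h`).**  Same with the LOWER `3³`-block
(`c 0 ∈ {0, -1}`) resampled and `t₀ < w 0 1`, for `h = z ∈ Z(G)`: `g_z` and `g_z · z⁻¹ = z⁻¹·𝟙_{x₀ ≤ t₀}` induce the
same transformation (`gaugeTransformZd_mul_central`), and the latter is trivial on the upper side. -/
theorem integral_layerTwist_eq_of_lower_resampled [SecondCountableTopology G] {N : ℕ}
    (ρ : G →* Matrix (Fin N) (Fin N) ℂ) (hρ : Continuous ρ) (β : ℝ) {w : Fin 4 → ℤ → ℤ}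
    (hw1 : ∀ i j, w i j + 1 ≤ w i (j + 1)) (Y : Finset (Fin 4 → ℤ))
    (hY : ∀ c : Fin 4 → ℤ, (c 0 = 0 ∨ c 0 = -1) → (∀ k, k ≠ 0 → |c k| ≤ 1) → c ∈ Y)
    {t₀ : ℤ} (ht₁ : t₀ < w 0 1) {z : G} (hz : z ∈ Subgroup.center G) (η : LGConfig 4 G)
    (f : LGConfig 4 G → ℝ) (hf : IsCylinder f (cellEdges w 0)) (hfm : Measurable f) :
    ∫ U, f U ∂(ymSpecification ρ β (regionEdges w Y) (gaugeTransformZd (twistFn t₀ z) η)) =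
      ∫ U, f U ∂(ymSpecification ρ β (regionEdges w Y) η) := by
  have hz' : z⁻¹ ∈ Subgroup.center G := inv_mem hz
  have hsw : gaugeTransformZd (twistFn t₀ z) = gaugeTransformZd (G := G) (fun x => twistFn t₀ z x * z⁻¹) :=
    (gaugeTransformZd_mul_central (twistFn t₀ z) hz').symm
  rw [hsw]
  refine integral_gaugeImage_eq ρ hρ β _ _ _ η (fun e he x hx hx₀ => ?_) f hf hfm
  obtain ⟨e₀, he₀, hx₀⟩ := hx₀
  have hc : frameCell w e ∉ Y := frameCell_not_mem hw1 he
  by_cases hfar : ∃ k, 2 ≤ |frameCell w e k|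
  · obtain ⟨k, hk⟩ := hfar
    exact (not_touch_of_far hw1 hk (mem_cellEdges_frameCell hw1 e) he₀ hx hx₀).elim
  · push Not at hfar
    have hnear : ∀ k, |frameCell w e k| ≤ 1 := fun k => by have := hfar k; omega
    have hc0 : frameCell w e 0 = 1 := by
      have h01 : ¬ (frameCell w e 0 = 0 ∨ frameCell w e 0 = -1) := fun h01 =>
        hc (hY _ h01 fun k _ => hnear k)
      have := hnear 0
      rw [abs_le] at this
      omega
    have hx0 := (endpt_coord (mem_cellEdges_frameCell hw1 e) hx 0).1
    rw [hc0] at hx0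
    have : t₀ < x 0 := by omega
    simp [twistFn, this]

/-! ## The located channel (C2): a visible centre twist is sandwiched -/

/-- **THE LOCATED CHANNEL (F1) (PROVED).**  With the centre row's `3³`-neighbours resampled and `t₀` in the centre
cell's height range, a centre twist that is VISIBLE at the centre cell forces FROZEN cells in BOTH normal
`3³`-blocks: a two-sided one-cell sandwich.  One-sided frozen faces, corners, staircases on one side, films of
`≥ 2` cells: exactly blind. -/
theorem layerTwist_visible_imp_sandwiched [SecondCountableTopology G] {N : ℕ}
    (ρ : G →* Matrix (Fin N) (Fin N) ℂ) (hρ : Continuous ρ) (β : ℝ) {w : Fin 4 → ℤ → ℤ}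
    (hw1 : ∀ i j, w i j + 1 ≤ w i (j + 1)) (Y : Finset (Fin 4 → ℤ))
    (hrow : ∀ c : Fin 4 → ℤ, c 0 = 0 → (∀ k, k ≠ 0 → |c k| ≤ 1) → c ∈ Y)
    {t₀ : ℤ} (ht₀ : w 0 0 ≤ t₀) (ht₁ : t₀ < w 0 1) {z : G} (hz : z ∈ Subgroup.center G) (η : LGConfig 4 G)
    (f : LGConfig 4 G → ℝ) (hf : IsCylinder f (cellEdges w 0)) (hfm : Measurable f)
    (hvis : ∫ U, f U ∂(ymSpecification ρ β (regionEdges w Y) (gaugeTransformZd (twistFn t₀ z) η)) ≠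
      ∫ U, f U ∂(ymSpecification ρ β (regionEdges w Y) η)) :
    (∃ c : Fin 4 → ℤ, c ∉ Y ∧ c 0 = 1 ∧ ∀ k, k ≠ 0 → |c k| ≤ 1) ∧
      (∃ c : Fin 4 → ℤ, c ∉ Y ∧ c 0 = -1 ∧ ∀ k, k ≠ 0 → |c k| ≤ 1) := by
  constructor
  · by_contra hno
    refine hvis (integral_layerTwist_eq_of_upper_resampled ρ hρ β hw1 Y (fun c h0 hk => ?_) ht₀ z η f hf hfm)
    rcases h0 with h0 | h0
    · exact hrow c h0 hk
    · by_contra hc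
      exact hno ⟨c, hc, h0, hk⟩
  · by_contra hno
    refine hvis (integral_layerTwist_eq_of_lower_resampled ρ hρ β hw1 Y (fun c h0 hk => ?_) ht₁ hz η f hf hfm)
    rcases h0 with h0 | h0
    · exact hrow c h0 hk
    · by_contra hc
      exact hno ⟨c, hc, h0, hk⟩

/-! ## The observable side (C3): face-to-face charged observables only -/

/-- **OBSERVABLE SIDE (F2), top (exact, PROVED; any `h`).**  With only the centre row's `3³`-block resampled — frozen
faces allowed on BOTH sides — a cylinder of centre-cell edges that does not reach the top face is blind to the layer
transformation. -/
theorem integral_layerTwist_eq_of_not_topReaching [SecondCountableTopology G] {N : ℕ}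
    (ρ : G →* Matrix (Fin N) (Fin N) ℂ) (hρ : Continuous ρ) (β : ℝ) {w : Fin 4 → ℤ → ℤ}
    (hw1 : ∀ i j, w i j + 1 ≤ w i (j + 1)) (Y : Finset (Fin 4 → ℤ))
    (hrow : ∀ c : Fin 4 → ℤ, c 0 = 0 → (∀ k, k ≠ 0 → |c k| ≤ 1) → c ∈ Y)
    {t₀ : ℤ} (ht₀ : w 0 0 ≤ t₀) (h : G) (η : LGConfig 4 G)
    (f : LGConfig 4 G → ℝ) (hf : IsCylinder f (notTopReaching w)) (hfm : Measurable f) :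
    ∫ U, f U ∂(ymSpecification ρ β (regionEdges w Y) (gaugeTransformZd (twistFn t₀ h) η)) =
      ∫ U, f U ∂(ymSpecification ρ β (regionEdges w Y) η) := by
  refine integral_gaugeImage_eq ρ hρ β _ _ _ η (fun e he x hx hx₀ => ?_) f hf hfm
  obtain ⟨e₀, he₀, hx₀⟩ := hx₀
  have he₀' : e₀ ∈ cellEdges w 0 := (Finset.mem_filter.1 he₀).1
  have hc : frameCell w e ∉ Y := frameCell_not_mem hw1 he
  by_cases hfar : ∃ k, 2 ≤ |frameCell w e k|
  · obtain ⟨k, hk⟩ := hfar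
    exact (not_touch_of_far hw1 hk (mem_cellEdges_frameCell hw1 e) he₀' hx hx₀).elim
  · push Not at hfar
    have hnear : ∀ k, |frameCell w e k| ≤ 1 := fun k => by have := hfar k; omega
    have hc0 : frameCell w e 0 ≠ 0 := fun h0 => hc (hrow _ h0 fun k _ => hnear k)
    have hxe := endpt_coord (mem_cellEdges_frameCell hw1 e) hx 0
    have hlt := endpt_lt_top_of_notTopReaching he₀ hx₀
    have h0 := hnear 0
    rw [abs_le] at h0
    by_cases hup : frameCell w e 0 = 1
    · rw [hup] at hxe
      omega
    · have hdn : frameCell w e 0 = -1 := by omega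
      rw [hdn] at hxe
      norm_num at hxe
      have : ¬ t₀ < x 0 := by omega
      simp [twistFn, this]

/-- **OBSERVABLE SIDE (F2), bottom (exact, PROVED; central `z`).**  Same for cylinders of centre-cell edges based
strictly above the bottom face. Together with the top version: a visible centre twist needs an observable depending
on a top-reaching normal link AND on a bottom-face edge — a face-to-face charged observable. -/
theorem integral_layerTwist_eq_of_not_bottomTouching [SecondCountableTopology G] {N : ℕ}
    (ρ : G →* Matrix (Fin N) (Fin N) ℂ) (hρ : Continuous ρ) (β : ℝ) {w : Fin 4 → ℤ → ℤ}
    (hw1 : ∀ i j, w i j + 1 ≤ w i (j + 1)) (Y : Finset (Fin 4 → ℤ))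
    (hrow : ∀ c : Fin 4 → ℤ, c 0 = 0 → (∀ k, k ≠ 0 → |c k| ≤ 1) → c ∈ Y)
    {t₀ : ℤ} (ht₁ : t₀ < w 0 1) {z : G} (hz : z ∈ Subgroup.center G) (η : LGConfig 4 G)
    (f : LGConfig 4 G → ℝ) (hf : IsCylinder f (notBottomTouching w)) (hfm : Measurable f) :
    ∫ U, f U ∂(ymSpecification ρ β (regionEdges w Y) (gaugeTransformZd (twistFn t₀ z) η)) =
      ∫ U, f U ∂(ymSpecification ρ β (regionEdges w Y) η) := by
  have hz' : z⁻¹ ∈ Subgroup.center G := inv_mem hz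
  rw [(gaugeTransformZd_mul_central (twistFn t₀ z) hz').symm]
  refine integral_gaugeImage_eq ρ hρ β _ _ _ η (fun e he x hx hx₀ => ?_) f hf hfm
  obtain ⟨e₀, he₀, hx₀⟩ := hx₀
  have he₀' : e₀ ∈ cellEdges w 0 := (Finset.mem_filter.1 he₀).1
  have hc : frameCell w e ∉ Y := frameCell_not_mem hw1 he
  by_cases hfar : ∃ k, 2 ≤ |frameCell w e k|
  · obtain ⟨k, hk⟩ := hfar
    exact (not_touch_of_far hw1 hk (mem_cellEdges_frameCell hw1 e) he₀' hx hx₀).elim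
  · push Not at hfar
    have hnear : ∀ k, |frameCell w e k| ≤ 1 := fun k => by have := hfar k; omega
    have hc0 : frameCell w e 0 ≠ 0 := fun h0 => hc (hrow _ h0 fun k _ => hnear k)
    have hxe := endpt_coord (mem_cellEdges_frameCell hw1 e) hx 0
    have hlt := bottom_lt_endpt_of_notBottomTouching he₀ hx₀
    have h0 := hnear 0
    rw [abs_le] at h0
    by_cases hdn : frameCell w e 0 = -1
    · rw [hdn] at hxe
      norm_num at hxe
      omega
    · have hup : frameCell w e 0 = 1 := by omega
      rw [hup] at hxe
      have : t₀ < x 0 := by omega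
      simp [twistFn, this]

end Kernel

end Summit.QuantumFields.YangMills.Cruxes.IR.CruxIdea2g3

end
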